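import Summits.BirchSwinnertonDyer.Rank1Residual.Additive.RamifiedSevenGenusTrivialCharacterArtinUnit
import HarnessLib

set_option autoImplicit false

/-!
# `𝒞₇` genus road (crux `EllipticUnitValueSevenOfGZK`, K7r), the (5)-unit programme (SUMMON GENUS-UNIT-A5), File C2b-δ (memo S7 (α),
# D967's first scalar fact): ORTHOGONALITY AGAINST THE TRACE FORM — for characters `η, χ` of a finite group and the INTEGER
# coefficients `t(g) = η(g) + η(g)⁻¹ = tr_{ℚ(μ₆)/ℚ}(η(g)⁻¹)` (`η⁶ = 1`): `Σ_g t(g)·χ(g)⁻¹ = 0` unless `χ ∈ {η, η⁻¹}`,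
# and `= |G|` at `χ = η ≠ η⁻¹`; such an integer `t` EXISTS; sums supported on a subgroup (THEOREMS ONLY)

Cell bsd-cm, seat bsd-cm-k-ty1 g26 (literature-prover); memo `pub/bsd-cm/bsd-cm-k-ty1/g26/G45-typing-memo.md` S7 (α): «`χ|_G ∉ {η₁, η̄₁}`:
`χ(E₁) = Σ_g (η₁(g)⁻¹ + η₁(g))χ(g) = 12(δ + δ̄) = 0`».  With C2b-β's reduction (★★ `twistedUnit_eq_one_of_forall_even`), the successor's
`hvan` splits into (α) THIS FILE (first factor `Σ_g t_g χ(g)⁻¹ = 0` off `{η, η̄}`) and (γ) the `χ(Xₙ)` dictionary on `{η, η̄}`.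

* §1 `finsum_character_eq_zero_of_ne_one` (`Σ_g χ(g) = 0`, `χ ≠ 1`, any finite group), `finsum_character_mul_inv_eq_zero`
  (`Σ_g η(g)χ(g)⁻¹ = 0`, `χ ≠ η`), `finsum_character_mul_inv_self` (`= |G|`).
* §2 ★ `finsum_trace_mul_inv_eq_zero` — `Σ_g t(g)·χ(g)⁻¹ = 0` for `χ ∉ {η, η⁻¹}`, `(t g : ℂ) = η g + (η g)⁻¹`;
  `finsum_trace_mul_inv_self` — `= |G|` at `χ = η` when `η ≠ η⁻¹` (`η₁ = χ_Dω⁵` has order `6`).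
* §3 `exists_int_eq_add_inv_of_pow_six_eq_one` — `z⁶ = 1 ⇒ z + z⁻¹ ∈ {2, 1, −1, −2} ⊂ ℤ`; `exists_intTrace` — the INTEGER function `t`
  exists for any `η` with `η⁶ = 1` (so `E₁ ∈ ℤ[G]`, as C2b-β's integer exponents require).
* §4 `finsum_dite_mem_subgroup` — a sum over `Γ` of a function supported on a subgroup `H` is the sum over `H` (the road: `G = ` torsion
  subgroup of `Gal(F′ₙ/ℚ)`, `t` extended by `0`).

HONEST LABEL: character bookkeeping; no definition, no named fact, no instance; nothing closes; stmt-BirchSwinnertonDyer-19945 OPEN; K1ᵘ NOT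
proved (the `χ(Xₙ)` dictionary (γ) and File E ahead); no summit statement is proved by this seat.

## References
* J.-P. Serre, *Linear Representations of Finite Groups* (1977) §2.3–§2.4 (orthogonality of characters) [SerreLinearRepresentations1977];
  L. C. Washington, *Introduction to Cyclotomic Fields* (1997) Lemma 3.8, §8.3 [Washington1997]; S. Lang, *Cyclotomic Fields I–II* (1990)
  Ch. 3 §5 [Lang1990]; T. Tsuji, J. Number Theory 78 (1999) §3 (p. 6, `e_χ`) [Tsuji1999].
-/

noncomputable section

open scoped NumberField
open Field

namespace Summit.BirchSwinnertonDyer.Rank1Residual.Additive.GenusSeven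

section Orthogonality

variable {G : Type} [Group G] [Finite G]

/-! ## §1 Orthogonality of characters of a finite group -/

/-- **`Σ_g χ(g) = 0` for a non-trivial character** of a finite group (reindex by `g ↦ h g` with `χ(h) ≠ 1`).
[cite: SerreLinearRepresentations1977, §2.3] [cite: Washington1997, Lemma 3.8] -/
theorem finsum_character_eq_zero_of_ne_one (χ : G →* ℂˣ) (hχ : χ ≠ 1) : ∑ᶠ g : G, ((χ g : ℂˣ) : ℂ) = 0 := by
  classical
  haveI : Fintype G := Fintype.ofFinite G
  obtain ⟨h, hh⟩ : ∃ h : G, χ h ≠ 1 := by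
    by_contra hc
    push Not at hc
    exact hχ (MonoidHom.ext hc)
  have hsum : ∑ g : G, ((χ g : ℂˣ) : ℂ) = ((χ h : ℂˣ) : ℂ) * ∑ g : G, ((χ g : ℂˣ) : ℂ) := by
    rw [Finset.mul_sum]
    exact (Fintype.sum_equiv (Equiv.mulLeft h) _ _ fun g => by rw [Equiv.coe_mulLeft, map_mul, Units.val_mul]).symm
  have hne : ((χ h : ℂˣ) : ℂ) - 1 ≠ 0 := by
    rw [sub_ne_zero, Ne, Units.val_eq_one]; exact hh
  rw [finsum_eq_sum_of_fintype]
  have h2 : (((χ h : ℂˣ) : ℂ) - 1) * ∑ g : G, ((χ g : ℂˣ) : ℂ) = 0 := by rw [sub_mul, one_mul, ← hsum, sub_self]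
  exact (mul_eq_zero.mp h2).resolve_left hne

/-- **`Σ_g η(g)·χ(g)⁻¹ = 0` for `χ ≠ η`.** [cite: SerreLinearRepresentations1977, §2.3] -/
theorem finsum_character_mul_inv_eq_zero (η χ : G →* ℂˣ) (hχ : χ ≠ η) :
    ∑ᶠ g : G, ((η g : ℂˣ) : ℂ) * ((χ g : ℂˣ) : ℂ)⁻¹ = 0 := by
  have hne : η * χ⁻¹ ≠ 1 := by
    intro h1
    apply hχ
    refine MonoidHom.ext fun g => ?_
    have hg := DFunLike.congr_fun h1 g
    rw [MonoidHom.mul_apply, MonoidHom.inv_apply, MonoidHom.one_apply, mul_inv_eq_one] at hg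
    exact hg.symm
  have h := finsum_character_eq_zero_of_ne_one (η * χ⁻¹) hne
  simp only [MonoidHom.mul_apply, MonoidHom.inv_apply, Units.val_mul, Units.val_inv_eq_inv_val] at h
  exact h

/-- **`Σ_g η(g)·η(g)⁻¹ = |G|`.** [cite: SerreLinearRepresentations1977, §2.3] -/
theorem finsum_character_mul_inv_self (η : G →* ℂˣ) :
    ∑ᶠ g : G, ((η g : ℂˣ) : ℂ) * ((η g : ℂˣ) : ℂ)⁻¹ = Nat.card G := by
  classical
  haveI : Fintype G := Fintype.ofFinite G
  rw [finsum_eq_sum_of_fintype, Finset.sum_congr rfl fun g _ => mul_inv_cancel₀ (Units.ne_zero (η g)), Finset.sum_const,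
    Finset.card_univ, nsmul_eq_mul, mul_one, Nat.card_eq_fintype_card]

/-! ## §2 Orthogonality against the trace form `t = η + η⁻¹` -/

/-- ★ **`Σ_g t(g)·χ(g)⁻¹ = 0` for `χ ∉ {η, η⁻¹}`**, where `(t g : ℂ) = η(g) + η(g)⁻¹` (`= tr_{ℚ(μ₆)/ℚ}(η(g)⁻¹)` for `η⁶ = 1`):
the genus element `E₁ = Σ_g t(g)·g` is killed by every character outside the rational block `{η, η̄}` — memo S7 (α).
[cite: SerreLinearRepresentations1977, §2.3–§2.4] [cite: Tsuji1999, §3 (p. 6, «e_χ»)] -/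
theorem finsum_trace_mul_inv_eq_zero (η χ : G →* ℂˣ) (t : G → ℤ)
    (ht : ∀ g : G, (t g : ℂ) = ((η g : ℂˣ) : ℂ) + ((η g : ℂˣ) : ℂ)⁻¹) (h1 : χ ≠ η) (h2 : χ ≠ η⁻¹) :
    ∑ᶠ g : G, (t g : ℂ) * ((χ g : ℂˣ) : ℂ)⁻¹ = 0 := by
  classical
  haveI : Fintype G := Fintype.ofFinite G
  have hA := finsum_character_mul_inv_eq_zero η χ h1
  have hB := finsum_character_mul_inv_eq_zero η⁻¹ χ h2
  rw [finsum_eq_sum_of_fintype] at hA hB ⊢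
  simp only [MonoidHom.inv_apply, Units.val_inv_eq_inv_val] at hB
  rw [Finset.sum_congr rfl fun g _ => by rw [ht g, add_mul], Finset.sum_add_distrib, hA, hB, add_zero]

/-- **… and `= |G|` at `χ = η` when `η ≠ η⁻¹`** (`Σ η·η⁻¹ = |G|`, `Σ η⁻¹·η⁻¹ = Σ (η²)⁻¹… = 0` since `η⁻¹ ≠ η`).
[cite: SerreLinearRepresentations1977, §2.3] -/
theorem finsum_trace_mul_inv_self (η : G →* ℂˣ) (t : G → ℤ)
    (ht : ∀ g : G, (t g : ℂ) = ((η g : ℂˣ) : ℂ) + ((η g : ℂˣ) : ℂ)⁻¹) (hη : η ≠ η⁻¹) :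
    ∑ᶠ g : G, (t g : ℂ) * ((η g : ℂˣ) : ℂ)⁻¹ = Nat.card G := by
  classical
  haveI : Fintype G := Fintype.ofFinite G
  have hA := finsum_character_mul_inv_self η
  have hB := finsum_character_mul_inv_eq_zero η⁻¹ η hη
  rw [finsum_eq_sum_of_fintype] at hA hB ⊢
  simp only [MonoidHom.inv_apply, Units.val_inv_eq_inv_val] at hB
  rw [Finset.sum_congr rfl fun g _ => by rw [ht g, add_mul], Finset.sum_add_distrib, hA, hB, add_zero]

/-! ## §3 The trace of a sixth root of unity is an integer -/

/-- **`z⁶ = 1 ⇒ z + z⁻¹ ∈ ℤ`** (`z³ = ±1`; `z = ±1` or `z² ± z + 1 = 0`, so `z + z⁻¹ ∈ {2, −1, −2, 1}`).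
[cite: Washington1997, §8.3] -/
theorem exists_int_eq_add_inv_of_pow_six_eq_one {z : ℂ} (hz : z ^ 6 = 1) : ∃ k : ℤ, (k : ℂ) = z + z⁻¹ := by
  have hz0 : z ≠ 0 := by
    rintro rfl
    norm_num at hz
  have h3 : (z ^ 3) ^ 2 = 1 := by rw [← pow_mul]; exact hz
  rcases sq_eq_one_iff.mp h3 with h | h
  · -- `z³ = 1`: `(z − 1)(z² + z + 1) = 0`
    have hf : (z - 1) * (z ^ 2 + z + 1) = 0 := by linear_combination h
    rcases mul_eq_zero.mp hf with h1 | h1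
    · refine ⟨2, ?_⟩
      rw [sub_eq_zero.mp h1, inv_one]; norm_num
    · refine ⟨-1, ?_⟩
      have : z + z⁻¹ = -1 := by
        field_simp
        linear_combination h1
      rw [this]; norm_num
  · -- `z³ = −1`: `(z + 1)(z² − z + 1) = 0`
    have hf : (z + 1) * (z ^ 2 - z + 1) = 0 := by linear_combination h
    rcases mul_eq_zero.mp hf with h1 | h1
    · refine ⟨-2, ?_⟩
      rw [eq_neg_of_add_eq_zero_left h1, inv_neg, inv_one]; norm_num
    · refine ⟨1, ?_⟩
      have : z + z⁻¹ = 1 := by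
        field_simp
        linear_combination h1
      rw [this]; norm_num

omit [Finite G] in
/-- **The integer trace function exists**: for a character `η` with `η⁶ = 1` there is `t : G → ℤ` with
`(t g : ℂ) = η(g) + η(g)⁻¹` for all `g` — the coefficients of `E₁ = Σ_g tr_{ℚ(μ₆)/ℚ}(η(g)⁻¹)·g ∈ ℤ[G]`.
[cite: Washington1997, §8.3] [cite: Tsuji1999, §3 (p. 6)] -/
theorem exists_intTrace (η : G →* ℂˣ) (hη : ∀ g : G, η g ^ 6 = 1) :
    ∃ t : G → ℤ, ∀ g : G, (t g : ℂ) = ((η g : ℂˣ) : ℂ) + ((η g : ℂˣ) : ℂ)⁻¹ := by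
  have h : ∀ g : G, ∃ k : ℤ, (k : ℂ) = ((η g : ℂˣ) : ℂ) + ((η g : ℂˣ) : ℂ)⁻¹ := fun g =>
    exists_int_eq_add_inv_of_pow_six_eq_one (by rw [← Units.val_pow_eq_pow_val, hη g, Units.val_one])
  choose t ht using h
  exact ⟨t, ht⟩

end Orthogonality

/-! ## §4 Sums supported on a subgroup -/

section Support

open scoped Classical in
/-- **A sum over a finite group `Γ` of a function supported on a subgroup `H` is the sum over `H`.** (The road:
`Γ = Gal(F′ₙ/ℚ)`, `H` its torsion subgroup, `t` extended by zero.) [cite: SerreLinearRepresentations1977, §2.4] -/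
theorem finsum_dite_mem_subgroup {Γ : Type} [Group Γ] [Finite Γ] (H : Subgroup Γ) (f : H → ℂ) :
    ∑ᶠ γ : Γ, (if h : γ ∈ H then f ⟨γ, h⟩ else 0) = ∑ᶠ h : H, f h := by
  haveI : Fintype Γ := Fintype.ofFinite Γ
  rw [finsum_eq_sum_of_fintype, finsum_eq_sum_of_fintype]
  have h1 : ∑ γ : Γ, (if h : γ ∈ H then f ⟨γ, h⟩ else 0) =
      ∑ γ ∈ Finset.univ.filter (· ∈ H), (if h : γ ∈ H then f ⟨γ, h⟩ else 0) :=
    (Finset.sum_filter_of_ne fun γ _ hne => by by_contra hγ; exact hne (dif_neg hγ)).symm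
  rw [h1, Finset.sum_subtype (Finset.univ.filter (· ∈ H)) (p := (· ∈ H)) (fun γ => by simp)]
  exact Finset.sum_congr rfl fun h _ => by simp [h.2]

end Support

end Summit.BirchSwinnertonDyer.Rank1Residual.Additive.GenusSeven

end
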